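import Literature.Topology.FourManifolds.PathsAvoidPointsLocal
import Literature.Topology.FourManifolds.CloseMapsHomotopic
import Literature.AlgebraicTopology.Homotopy.HomotopyGroupsGeneralPosition

/-!
# Paths in a closed manifold of dimension `≥ 2` can be pushed off finitely many points, up to
# homotopy rel end points

Topic `Literature/Topology/FourManifolds` (infrastructure for the fact seat
`provefact-Literature.Geometry.Riemannian.LawsonMichelsohn1984_surrounding`: Wall's form of the
trading of `1`-handles chooses the return arc of Milnor's ideal circle, Lemma 8.3, in a prescribed
homotopy class of `V` and off the left-hand `0`-spheres, a finite set).  Everything here is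
**proved**; no definitions.

* `exists_isOpenEmbedding_apply_zero_eq_range_subset` — a Euclidean chart `j : ℝⁿ ↪ V` at `p` with
  range inside a prescribed open neighbourhood (the tree's
  `Literature.AlgebraicTopology.Homotopy.exists_isOpenEmbedding_apply_zero_eq` shrunk by
  `OpenPartialHomeomorph.univBall`, as in `HomotopyS4Freedman.lean`);
* `Path.exists_homotopic_forall_notMem` — **general position for paths against points**: in a
  compact boundaryless `C^∞` manifold `V` of dimension `n ≥ 2`, a path whose end points miss a
  finite set `F` is homotopic rel end points to a path missing `F`.  Proof: induction over `F`;
  one point `p` is removed by the local general-position lemma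
  `exists_continuousMap_eqOn_forall_ne_local` (`PathsAvoidPointsLocal.lean`: `dim [0, 1] = 1 < n`)
  applied in a chart at `p` so small that it misses the other points and lies in one member of
  the cover of `exists_cover_homotopic_of_mapsTo` (`CloseMapsHomotopic.lean`), which then makes
  the push a homotopy, stationary at the end points.

## References

* M. W. Hirsch, *Differential Topology* (1976), Ch. 3, Thm. 2.5 (general position / transversality
  to a point). [HirschDT1976]
* J. Milnor, *Lectures on the h-cobordism theorem* (1965), proof of Lemma 8.3 (PDF pp. 55–56:
  "a path avoiding the left-hand `0`-spheres"). [MilnorHCobordism1965]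
-/

open scoped Manifold ContDiff Topology unitInterval
open Set Function Filter Metric Module Topology

noncomputable section

namespace Literature.Topology.FourManifolds

universe u

section Chart

variable {E : Type*} [NormedAddCommGroup E] [NormedSpace ℝ E] {M : Type*} [TopologicalSpace M]
  [ChartedSpace E M]

/-- **A Euclidean chart at a point inside a prescribed open neighbourhood**: for `p ∈ O` open in
a space charted on `E` there is an open embedding `j : E ↪ M` with `j 0 = p` and
`range j ⊆ O`. [folklore] -/
theorem exists_isOpenEmbedding_apply_zero_eq_range_subset (p : M) {O : Set M}
    (hO : IsOpen O) (hp : p ∈ O) : ∃ j : E → M, IsOpenEmbedding j ∧ j 0 = p ∧ ∀ v, j v ∈ O := by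
  obtain ⟨i, hi, hi0⟩ :=
    Literature.AlgebraicTopology.Homotopy.exists_isOpenEmbedding_apply_zero_eq (E := E) p
  obtain ⟨r, hr, hball⟩ : ∃ r > 0, ball (0 : E) r ⊆ i ⁻¹' O := by
    refine Metric.isOpen_iff.1 (hO.preimage hi.continuous) 0 ?_
    change i 0 ∈ O
    rwa [hi0]
  refine ⟨i ∘ OpenPartialHomeomorph.univBall (0 : E) r,
    hi.comp ((OpenPartialHomeomorph.univBall (0 : E) r).to_isOpenEmbedding
      (OpenPartialHomeomorph.univBall_source 0 r)), ?_, fun v => ?_⟩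
  · simp only [Function.comp_apply, OpenPartialHomeomorph.univBall_apply_zero, hi0]
  · refine hball ?_
    rw [← OpenPartialHomeomorph.univBall_target (0 : E) hr]
    exact OpenPartialHomeomorph.map_source _
      (by rw [OpenPartialHomeomorph.univBall_source]; exact mem_univ _)

end Chart

section Paths

variable {n : ℕ} {V : Type u} [TopologicalSpace V] [T2Space V] [CompactSpace V]
  [ChartedSpace (EuclideanSpace ℝ (Fin n)) V] [IsManifold (𝓡 n) ∞ V]

omit [CompactSpace V] [IsManifold (𝓡 n) ∞ V] in
/-- **Removing one point**: given the cover `U` of `exists_cover_homotopic_of_mapsTo`, a path with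
end points different from `p` is homotopic rel end points to a path missing `p` which agrees with
it except at points where both lie in a prescribed open neighbourhood `O ∋ p`. [folklore] -/
theorem Path.exists_homotopic_forall_ne (hn : 2 ≤ n)
    {U : V → Set V} (hUo : ∀ y, IsOpen (U y)) (hUy : ∀ y, y ∈ U y)
    (hU : ∀ (f g : C(unitInterval, V)), (∀ u, ∃ y, f u ∈ U y ∧ g u ∈ U y) →
      ∃ H : f.Homotopy g, ∀ s u, f u = g u → H (s, u) = f u)
    {a b : V} (γ : Path a b) (p : V) (ha : a ≠ p) (hb : b ≠ p) {O : Set V} (hO : IsOpen O)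
    (hpO : p ∈ O) :
    ∃ γ' : Path a b, (∀ t, γ' t ≠ p) ∧ (∀ t, γ' t = γ t ∨ (γ t ∈ O ∧ γ' t ∈ O)) ∧
      γ.Homotopic γ' := by
  -- a chart at `p` inside `O ∩ U p`
  obtain ⟨j, hj, hj0, hjO⟩ := exists_isOpenEmbedding_apply_zero_eq_range_subset
    (E := EuclideanSpace ℝ (Fin n)) p ((hO.inter (hUo p))) ⟨hpO, hUy p⟩
  -- push `γ` off `p = j 0`, rel the end points
  have hZ : IsClosed ({0, 1} : Set unitInterval) := (Set.toFinite _).isClosed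
  have hfZ : ∀ z ∈ ({0, 1} : Set unitInterval), (γ : C(unitInterval, V)) z ≠ j 0 := by
    intro z hz
    rcases hz with rfl | rfl
    · simpa [hj0] using ha
    · simpa [hj0] using hb
  have hdim : finrank ℝ ℝ < finrank ℝ (EuclideanSpace ℝ (Fin n)) := by
    rw [Module.finrank_self, finrank_euclideanSpace_fin]; omega
  obtain ⟨g, hgZ, hgp, hloc⟩ := exists_continuousMap_eqOn_forall_ne_local
    (ι := fun x : unitInterval => (x : ℝ)) (π := projIcc (0 : ℝ) 1 zero_le_one)
    continuous_subtype_val (LipschitzWith.projIcc _).uniformContinuous (fun x => projIcc_val _ x)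
    hdim hj (γ : C(unitInterval, V)) hZ hfZ one_pos
  have hg0 : g 0 = a := by
    have := hgZ (show (0 : unitInterval) ∈ ({0, 1} : Set unitInterval) from Or.inl rfl)
    simpa using this
  have hg1 : g 1 = b := by
    have := hgZ (show (1 : unitInterval) ∈ ({0, 1} : Set unitInterval) from Or.inr rfl)
    simpa using this
  refine ⟨⟨g, hg0, hg1⟩, fun t => by rw [← hj0]; exact hgp t, fun t => ?_, ?_⟩
  · rcases hloc t with h | ⟨h1, h2⟩
    · exact Or.inl h
    · right
      obtain ⟨v, -, hv⟩ := h1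
      obtain ⟨w, -, hw⟩ := h2
      exact ⟨hv ▸ (hjO v).1, hw ▸ (hjO w).1⟩
  · -- the homotopy, stationary at the end points
    obtain ⟨H, hH⟩ := hU (γ : C(unitInterval, V)) g fun u => by
      rcases hloc u with h | ⟨h1, h2⟩
      · exact ⟨γ u, hUy _, h ▸ hUy _⟩
      · obtain ⟨v, -, hv⟩ := h1
        obtain ⟨w, -, hw⟩ := h2
        exact ⟨p, hv ▸ (hjO v).2, hw ▸ (hjO w).2⟩
    refine ⟨{ toHomotopy := H, prop' := fun s t ht => ?_ }⟩
    have hst : H (s, t) = γ t := hH s t (hgZ ht).symm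
    show H (s, t) = _
    rw [hst]
    rfl

/-- **General position for paths against finitely many points.**  In a compact boundaryless
`C^∞` manifold `V` of dimension `n ≥ 2`, a path whose end points miss a finite set `F` is
homotopic rel end points to a path missing `F`. [cite: HirschDT1976, Ch. 3 Thm. 2.5] -/
theorem Path.exists_homotopic_forall_notMem (hn : 2 ≤ n) {F : Set V} (hF : F.Finite) {a b : V}
    (γ : Path a b) (ha : a ∉ F) (hb : b ∉ F) :
    ∃ γ' : Path a b, (∀ t, γ' t ∉ F) ∧ γ.Homotopic γ' := by
  obtain ⟨U, hUo, hUy, hU⟩ := exists_cover_homotopic_of_mapsTo (n := n) V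
  -- induction over the finite set
  induction F, hF using Set.Finite.induction_on with
  | empty => exact ⟨γ, fun t h => h, Path.Homotopic.refl γ⟩
  | @insert p F₀ hpF₀ hF₀ ih =>
    obtain ⟨γ₁, hγ₁, hhom₁⟩ := ih (fun h => ha (mem_insert_of_mem _ h))
      (fun h => hb (mem_insert_of_mem _ h))
    have hap : a ≠ p := fun h => ha (h ▸ mem_insert _ _)
    have hbp : b ≠ p := fun h => hb (h ▸ mem_insert _ _)
    have hO : IsOpen (F₀ᶜ : Set V) := hF₀.isClosed.isOpen_compl
    obtain ⟨γ', hγ'p, hγ'loc, hhom⟩ := Path.exists_homotopic_forall_ne hn hUo hUy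
      (fun f g h => hU f g h) γ₁ p hap hbp hO hpF₀
    refine ⟨γ', fun t ht => ?_, hhom₁.trans hhom⟩
    rcases mem_insert_iff.1 ht with h | h
    · exact hγ'p t h
    · rcases hγ'loc t with h' | ⟨-, h2⟩
      · exact hγ₁ t (h' ▸ h)
      · exact h2 h

end Paths

end Literature.Topology.FourManifolds

end
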